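import Summits.AtomisticToContinuum.HydrodynamicLimit.Theorems.CorrectorPressureDecay.Negative.Frame

/-!
# Negative knowledge for `CorrectorPressureDecay` (stmt-AtomisticToContinuum-14135), IVa: the radial amplitude witness `hW`

From the standing disprover's `Cruxes/CorrectorPressureDecay/Disproof.lean` §(a.2)
(refuter-cdisprove-stmt-AtomisticToContinuum-14135-0). The witness behind the refutation of the all-amplitudes variant
(`AllAmplitudes.lean`): a RADIAL admissible one-body observable equal to `1` on the unit ball,
`hW = 1 − a·tent_{5/2}(|v|²) − b·tent_{9/2}(|v|²)` with `(a, b)` solving `E h = 0`, `E |v|² h = 0` — the determinant is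
`≥ e₁ e₂ > 0` from the supports of the tents alone (no Gaussian integral is evaluated); `hW ⊥ v` by reflection
evenness, so `hW ⊥ span(1, v, |v|²)` (`hW_orthogonal`); `|hW| ≤ HW := 1 + |a| + |b|`.
-/

noncomputable section

open MeasureTheory ProbabilityTheory Set Filter Topology
open scoped ENNReal

namespace Summit.AtomisticToContinuum.HydrodynamicLimit.Theorems.CorrectorPressureDecayNegative.Amplitude

open Literature.MathematicalPhysics.KineticTheory (T3 V3 hsDiameter localGibbsLaw localGibbsMeasure
  localGibbsProfile)
open Literature.Analysis.FluidPDE (HardSphereFlow Config configEnergy)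

/-! ### (a.2) The amplitude clause `∃κ` is load-bearing

Witness shape: a RADIAL admissible `hW` equal to `1` on the unit ball `{|v|² ≤ 1}`, built from two tents in
`|v|²` on `[2,3]` and `[4,5]` with coefficients solving the `2×2` system `E h = 0`, `E |v|² h = 0` (determinant
`≥ e₁e₂ > 0` by support considerations — no Gaussian integral is ever evaluated). -/

section Amplitude

open Literature.MathematicalPhysics.KineticTheory

/-- Sign flip of the `k`-th coordinate of `ℝ³`, a linear isometry (`LinearIsometryEquiv.piLpCongrRight`). -/
def flipLIE (k : Fin 3) : V3 ≃ₗᵢ[ℝ] V3 :=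
  LinearIsometryEquiv.piLpCongrRight 2 fun i =>
    if i = k then LinearIsometryEquiv.neg ℝ else LinearIsometryEquiv.refl ℝ ℝ

/-- Evaluation of the coordinate reflection. [folklore] -/
theorem flipLIE_apply (k : Fin 3) (v : V3) (i : Fin 3) :
    flipLIE k v i = if i = k then -v i else v i :=
  coordFlip_apply k v i

/-- The tent of height 1 and half-width 1/2 centred at `c`. -/
def tent (c s : ℝ) : ℝ := max 0 (1 - 2 * |s - c|)

/-- Auxiliary fact `tent_nonneg` of the amplitude witness construction (see the module docstring). [folklore] -/
theorem tent_nonneg (c s : ℝ) : 0 ≤ tent c s := le_max_left _ _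

/-- Auxiliary fact `tent_le_one` of the amplitude witness construction (see the module docstring). [folklore] -/
theorem tent_le_one (c s : ℝ) : tent c s ≤ 1 :=
  max_le zero_le_one (by linarith [abs_nonneg (s - c)])

/-- Auxiliary fact `abs_tent_le_one` of the amplitude witness construction (see the module docstring). [folklore] -/
theorem abs_tent_le_one (c s : ℝ) : |tent c s| ≤ 1 := by
  rw [abs_of_nonneg (tent_nonneg c s)]
  exact tent_le_one c s

/-- Auxiliary fact `tent_eq_zero_of_le` of the amplitude witness construction (see the module docstring). [folklore] -/
theorem tent_eq_zero_of_le {c s : ℝ} (h : s ≤ c - 1 / 2) : tent c s = 0 := by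
  rw [tent, max_eq_left]
  rw [abs_of_nonpos (by linarith)]
  linarith

/-- Auxiliary fact `tent_eq_zero_of_ge` of the amplitude witness construction (see the module docstring). [folklore] -/
theorem tent_eq_zero_of_ge {c s : ℝ} (h : c + 1 / 2 ≤ s) : tent c s = 0 := by
  rw [tent, max_eq_left]
  rw [abs_of_nonneg (by linarith)]
  linarith

/-- Auxiliary fact `tent_self` of the amplitude witness construction (see the module docstring). [folklore] -/
theorem tent_self (c : ℝ) : tent c c = 1 := by simp [tent]

/-- Auxiliary fact `continuous_tent` of the amplitude witness construction (see the module docstring). [folklore] -/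
@[fun_prop]
theorem continuous_tent (c : ℝ) : Continuous (tent c) := by
  unfold tent
  fun_prop

/-- First and weighted Gaussian moments of the two tents in `|v|²` (named, never evaluated). -/
def e₁ : ℝ := ∫ v, tent (5 / 2) (‖v‖ ^ 2) ∂stdGaussian V3
/-- Auxiliary fact `e₂` of the amplitude witness construction (see the module docstring). -/
def e₂ : ℝ := ∫ v, tent (9 / 2) (‖v‖ ^ 2) ∂stdGaussian V3
/-- Auxiliary fact `m₁` of the amplitude witness construction (see the module docstring). -/
def m₁ : ℝ := ∫ v, ‖v‖ ^ 2 * tent (5 / 2) (‖v‖ ^ 2) ∂stdGaussian V3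
/-- Auxiliary fact `m₂` of the amplitude witness construction (see the module docstring). -/
def m₂ : ℝ := ∫ v, ‖v‖ ^ 2 * tent (9 / 2) (‖v‖ ^ 2) ∂stdGaussian V3
/-- Auxiliary fact `detW` of the amplitude witness construction (see the module docstring). -/
def detW : ℝ := e₁ * m₂ - e₂ * m₁
/-- Auxiliary fact `aW` of the amplitude witness construction (see the module docstring). -/
def aW : ℝ := (m₂ - 3 * e₂) / detW
/-- Auxiliary fact `bW` of the amplitude witness construction (see the module docstring). -/
def bW : ℝ := (3 * e₁ - m₁) / detW

/-- The radial witness `hW(v) = 1 − a·tent_{5/2}(|v|²) − b·tent_{9/2}(|v|²)`. -/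
def hW (v : V3) : ℝ := 1 - aW * tent (5 / 2) (‖v‖ ^ 2) - bW * tent (9 / 2) (‖v‖ ^ 2)

/-- Auxiliary fact `continuous_hW` of the amplitude witness construction (see the module docstring). [folklore] -/
@[fun_prop]
theorem continuous_hW : Continuous hW := by
  unfold hW
  have h1 := continuous_tent (5 / 2)
  have h2 := continuous_tent (9 / 2)
  fun_prop

/-- `hW = 1` on the unit ball. [folklore] -/
theorem hW_eq_one {v : V3} (hv : ‖v‖ ^ 2 ≤ 1) : hW v = 1 := by
  have h1 : tent (5 / 2) (‖v‖ ^ 2) = 0 := tent_eq_zero_of_le (by linarith)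
  have h2 : tent (9 / 2) (‖v‖ ^ 2) = 0 := tent_eq_zero_of_le (by linarith)
  simp [hW, h1, h2]

/-- The sup bound `|hW| ≤ 1 + |a| + |b|`. -/
def HW : ℝ := 1 + |aW| + |bW|

/-- Auxiliary fact `abs_hW_le` of the amplitude witness construction (see the module docstring). [folklore] -/
theorem abs_hW_le (v : V3) : |hW v| ≤ HW := by
  rw [hW, HW]
  have h1 := abs_tent_le_one (5 / 2) (‖v‖ ^ 2)
  have h2 := abs_tent_le_one (9 / 2) (‖v‖ ^ 2)
  calc |1 - aW * tent (5 / 2) (‖v‖ ^ 2) - bW * tent (9 / 2) (‖v‖ ^ 2)|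
      ≤ |1 - aW * tent (5 / 2) (‖v‖ ^ 2)| + |bW * tent (9 / 2) (‖v‖ ^ 2)| := abs_sub _ _
    _ ≤ (|(1 : ℝ)| + |aW * tent (5 / 2) (‖v‖ ^ 2)|) + |bW * tent (9 / 2) (‖v‖ ^ 2)| := by
        gcongr; exact abs_sub _ _
    _ = 1 + |aW| * |tent (5 / 2) (‖v‖ ^ 2)| + |bW| * |tent (9 / 2) (‖v‖ ^ 2)| := by
        rw [abs_one, abs_mul, abs_mul]
    _ ≤ 1 + |aW| * 1 + |bW| * 1 := by gcongr
    _ = 1 + |aW| + |bW| := by ring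

/-- Auxiliary fact `one_le_HW` of the amplitude witness construction (see the module docstring). [folklore] -/
theorem one_le_HW : 1 ≤ HW := by
  rw [HW]
  have := abs_nonneg aW
  have := abs_nonneg bW
  linarith

/-- `hW` is invariant under every coordinate reflection (it is radial). [folklore] -/
theorem hW_flip (k : Fin 3) (v : V3) : hW (flipLIE k v) = hW v := by
  simp only [hW, LinearIsometryEquiv.norm_map]

/-! #### Positivity of the tent moments and of the determinant -/

/-- The tents in `|v|²` are integrable under the standard Gaussian (bounded by 1). [folklore] -/
theorem integrable_tent_normSq (c : ℝ) : Integrable (fun v : V3 => tent c (‖v‖ ^ 2)) (stdGaussian V3) :=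
  (integrable_const (1 : ℝ)).mono' (by fun_prop : Continuous fun v : V3 =>
    tent c (‖v‖ ^ 2)).aestronglyMeasurable (ae_of_all _ fun v => by
      rw [Real.norm_eq_abs]; exact abs_tent_le_one _ _)

/-- Auxiliary fact `integrable_normSq_mul_tent` of the amplitude witness construction (see the module docstring). [folklore] -/
theorem integrable_normSq_mul_tent (c : ℝ) :
    Integrable (fun v : V3 => ‖v‖ ^ 2 * tent c (‖v‖ ^ 2)) (stdGaussian V3) := by
  have h := integrable_norm_sq_stdGaussian (ι := Fin 3)
  refine (h.bdd_mul (c := 1) (by fun_prop : Continuous fun v : V3 =>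
    tent c (‖v‖ ^ 2)).aestronglyMeasurable (ae_of_all _ fun v => ?_)).congr ?_
  · rw [Real.norm_eq_abs]; exact abs_tent_le_one _ _
  · exact ae_of_all _ fun v => by simp [mul_comm]

/-- Auxiliary fact `tent_moment_pos` of the amplitude witness construction (see the module docstring). [folklore] -/
theorem tent_moment_pos {c : ℝ} (hc : 0 ≤ c) : 0 < ∫ v, tent c (‖v‖ ^ 2) ∂stdGaussian V3 := by
  rw [integral_pos_iff_support_of_nonneg (fun v => tent_nonneg _ _) (integrable_tent_normSq c)]
  have hopen : IsOpen (Function.support fun v : V3 => tent c (‖v‖ ^ 2)) :=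
    isOpen_ne_fun (by fun_prop) continuous_const
  obtain ⟨v, hv⟩ := exists_norm_sq_eq hc
  exact stdGaussian_pos_of_isOpen hopen ⟨v, by rw [Function.mem_support, hv, tent_self]; norm_num⟩

/-- Auxiliary fact `e₁_pos` of the amplitude witness construction (see the module docstring). [folklore] -/
theorem e₁_pos : 0 < e₁ := tent_moment_pos (by norm_num)
/-- Auxiliary fact `e₂_pos` of the amplitude witness construction (see the module docstring). [folklore] -/
theorem e₂_pos : 0 < e₂ := tent_moment_pos (by norm_num)

/-- `m₁ ≤ 3 e₁`: on the support of `tent_{5/2}` the weight `|v|²` is `≤ 3`. [folklore] -/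
theorem m₁_le : m₁ ≤ 3 * e₁ := by
  rw [m₁, e₁, ← integral_const_mul]
  refine integral_mono (integrable_normSq_mul_tent _) ((integrable_tent_normSq _).const_mul 3) fun v => ?_
  by_cases h : ‖v‖ ^ 2 ≤ 3
  · exact mul_le_mul_of_nonneg_right h (tent_nonneg _ _)
  · have : tent (5 / 2) (‖v‖ ^ 2) = 0 := tent_eq_zero_of_ge (by linarith)
    simp [this]

/-- `4 e₂ ≤ m₂`: on the support of `tent_{9/2}` the weight `|v|²` is `≥ 4`. [folklore] -/
theorem le_m₂ : 4 * e₂ ≤ m₂ := by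
  rw [m₂, e₂, ← integral_const_mul]
  refine integral_mono ((integrable_tent_normSq _).const_mul 4) (integrable_normSq_mul_tent _) fun v => ?_
  by_cases h : 4 ≤ ‖v‖ ^ 2
  · exact mul_le_mul_of_nonneg_right h (tent_nonneg _ _)
  · have : tent (9 / 2) (‖v‖ ^ 2) = 0 := tent_eq_zero_of_le (by linarith)
    simp [this]

/-- Auxiliary fact `detW_pos` of the amplitude witness construction (see the module docstring). [folklore] -/
theorem detW_pos : 0 < detW := by
  have h1 := m₁_le
  have h2 := le_m₂
  have h3 := e₁_pos
  have h4 := e₂_pos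
  rw [detW]
  nlinarith

/-- The two defining equations of `(a, b)`. [folklore] -/
theorem aW_bW_eq_one : aW * e₁ + bW * e₂ = 1 := by
  have hd := detW_pos.ne'
  rw [aW, bW, div_mul_eq_mul_div, div_mul_eq_mul_div, ← add_div, div_eq_one_iff_eq hd, detW]
  ring

/-- Auxiliary fact `aW_bW_eq_three` of the amplitude witness construction (see the module docstring). [folklore] -/
theorem aW_bW_eq_three : aW * m₁ + bW * m₂ = 3 := by
  have hd := detW_pos.ne'
  rw [aW, bW, div_mul_eq_mul_div, div_mul_eq_mul_div, ← add_div, div_eq_iff hd, detW]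
  ring

/-! #### Admissibility of `hW` -/

/-- `hW · f` is integrable for integrable `f` (bounded `hW`). [folklore] -/
theorem integrable_hW_mul {f : V3 → ℝ} (hf : Integrable f (stdGaussian V3)) :
    Integrable (fun v => hW v * f v) (stdGaussian V3) :=
  hf.bdd_mul continuous_hW.aestronglyMeasurable (ae_of_all _ fun v => by
    rw [Real.norm_eq_abs]; exact abs_hW_le v)

/-- `E hW = 0`. [folklore] -/
theorem integral_hW : ∫ v, hW v ∂stdGaussian V3 = 0 := by
  have h1 := integrable_tent_normSq (5 / 2)
  have h2 := integrable_tent_normSq (9 / 2)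
  have hA : Integrable (fun v : V3 => (1 : ℝ) - aW * tent (5 / 2) (‖v‖ ^ 2)) (stdGaussian V3) :=
    (integrable_const _).sub (h1.const_mul _)
  have hB : Integrable (fun v : V3 => bW * tent (9 / 2) (‖v‖ ^ 2)) (stdGaussian V3) := h2.const_mul _
  have hA1 : Integrable (fun v : V3 => aW * tent (5 / 2) (‖v‖ ^ 2)) (stdGaussian V3) := h1.const_mul _
  have : ∫ v, hW v ∂stdGaussian V3 = 1 - aW * e₁ - bW * e₂ := by
    simp only [hW]
    rw [integral_sub hA hB, integral_sub (integrable_const _) hA1, integral_const_mul, integral_const_mul]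
    simp [e₁, e₂]
  rw [this]
  linarith [aW_bW_eq_one]

/-- `E |v|² hW = 0`. [folklore] -/
theorem integral_normSq_hW : ∫ v, hW v * ‖v‖ ^ 2 ∂stdGaussian V3 = 0 := by
  have h0 := integrable_norm_sq_stdGaussian (ι := Fin 3)
  have h1 := integrable_normSq_mul_tent (5 / 2)
  have h2 := integrable_normSq_mul_tent (9 / 2)
  have hexp : ∀ v : V3, hW v * ‖v‖ ^ 2 =
      ‖v‖ ^ 2 - aW * (‖v‖ ^ 2 * tent (5 / 2) (‖v‖ ^ 2)) - bW * (‖v‖ ^ 2 * tent (9 / 2) (‖v‖ ^ 2)) := by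
    intro v; rw [hW]; ring
  simp_rw [hexp]
  have hA : Integrable (fun v : V3 => ‖v‖ ^ 2 - aW * (‖v‖ ^ 2 * tent (5 / 2) (‖v‖ ^ 2))) (stdGaussian V3) :=
    h0.sub (h1.const_mul _)
  have hB : Integrable (fun v : V3 => bW * (‖v‖ ^ 2 * tent (9 / 2) (‖v‖ ^ 2))) (stdGaussian V3) :=
    h2.const_mul _
  have hA1 : Integrable (fun v : V3 => aW * (‖v‖ ^ 2 * tent (5 / 2) (‖v‖ ^ 2))) (stdGaussian V3) :=
    h1.const_mul _
  rw [integral_sub hA hB, integral_sub h0 hA1, integral_const_mul, integral_const_mul,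
    integral_norm_sq_stdGaussian]
  simp only [Fintype.card_fin, Nat.cast_ofNat]
  rw [show (∫ v : V3, ‖v‖ ^ 2 * tent (5 / 2) (‖v‖ ^ 2) ∂stdGaussian V3) = m₁ from rfl,
    show (∫ v : V3, ‖v‖ ^ 2 * tent (9 / 2) (‖v‖ ^ 2) ∂stdGaussian V3) = m₂ from rfl]
  linarith [aW_bW_eq_three]

/-- **`hW` is admissible**: `hW ⊥ span(1, v, |v|²)` in `L²(stdGaussian)`. [folklore] -/
theorem hW_orthogonal (c₀ c₂ : ℝ) (b : V3) :
    ∫ v, hW v * (c₀ + inner ℝ b v + c₂ * ‖v‖ ^ 2) ∂stdGaussian V3 = 0 := by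
  have hcoord : ∀ l : Fin 3, Integrable (fun v : V3 => v l) (stdGaussian V3) := fun l =>
    (memLp_coord_stdGaussian l 2 (by simp)).integrable one_le_two
  have hodd : ∀ l : Fin 3, ∫ v, hW v * v l ∂stdGaussian V3 = 0 := by
    intro l
    refine integral_stdGaussian_eq_zero_of_odd (flipLIE l) fun v => ?_
    rw [hW_flip, flipLIE_apply, if_pos rfl]
    ring
  have hsplit : ∀ v : V3, hW v * (c₀ + inner ℝ b v + c₂ * ‖v‖ ^ 2) =
      (c₀ * hW v + c₂ * (hW v * ‖v‖ ^ 2)) +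
        ((b 0 * (hW v * v 0) + b 1 * (hW v * v 1)) + b 2 * (hW v * v 2)) := by
    intro v; rw [quadWeight_eq]; ring
  simp_rw [hsplit]
  have hI0 : Integrable hW (stdGaussian V3) := by
    simpa using integrable_hW_mul (integrable_const (1 : ℝ))
  have hI2 : Integrable (fun v => hW v * ‖v‖ ^ 2) (stdGaussian V3) :=
    integrable_hW_mul (integrable_norm_sq_stdGaussian (ι := Fin 3))
  have hIl : ∀ l : Fin 3, Integrable (fun v : V3 => hW v * v l) (stdGaussian V3) := fun l =>
    integrable_hW_mul (hcoord l)
  have hP1 : Integrable (fun v : V3 => c₀ * hW v + c₂ * (hW v * ‖v‖ ^ 2)) (stdGaussian V3) :=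
    (hI0.const_mul _).add (hI2.const_mul _)
  have hP2a : Integrable (fun v : V3 => b 0 * (hW v * v 0) + b 1 * (hW v * v 1)) (stdGaussian V3) :=
    ((hIl 0).const_mul _).add ((hIl 1).const_mul _)
  have hP2 : Integrable (fun v : V3 => (b 0 * (hW v * v 0) + b 1 * (hW v * v 1)) + b 2 * (hW v * v 2))
      (stdGaussian V3) := hP2a.add ((hIl 2).const_mul _)
  rw [integral_add hP1 hP2, integral_add (hI0.const_mul _) (hI2.const_mul _),
    integral_add hP2a ((hIl 2).const_mul _), integral_add ((hIl 0).const_mul _) ((hIl 1).const_mul _)]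
  simp only [integral_const_mul, integral_hW, integral_normSq_hW, hodd]
  ring

end Amplitude

end Summit.AtomisticToContinuum.HydrodynamicLimit.Theorems.CorrectorPressureDecayNegative.Amplitude
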